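import Summits.BirchSwinnertonDyer.BirchSwinnertonDyer.Theorems.KolyvaginRoadThreeKernelHL
import Summits.BirchSwinnertonDyer.BirchSwinnertonDyer.Theorems.KolyvaginRoadThreeLevelData
import HarnessLib

/-!
# Route `KolyvaginRoadThree`, crux `ZhangSharpFrameAtThree` (item stmt-BirchSwinnertonDyer-19153): the A1
# kernel with the crux in the CLOSABLE-IN-PRINCIPLE shape — HL-sharp AND the level-`n` seam as a PREMISE of the
# crux (cell `bsd-stepL`, seat `bsd-stepL-zhang3-p1`; `--supports 19153`, helper; sibling of
# `KolyvaginRoadThreeKernelX11b.lean` p422717 and `KolyvaginRoadThreeKernelHL.lean` p424749)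

THEOREMS ONLY (no definition, no named fact, no `sorry`); nothing about Kolyvagin's conjecture at `p = 3` is
asserted; CONDITIONAL on every binder; nothing is booked (PARTITION: O2@3 × A1 (1 116 TRUE-OPEN classes; cw
248 943) — types-the-object-of; closes: none). NO Theses import (the route file may import this module).

WHY. The conclusion of the crux, `∃ (n : ℕ) (d : KolyvaginHeegnerData Dt β ι n), …`, can only be INHABITED by
exhibiting the point `y(n) ∈ E(K[n])` (field `y`/`map_y` of the datum) — *"the point `x_n` is rational over
`K_n`"* (Gross 1991, §3), CM theory that the tree holds ONLY as named facts
(`phi_heegnerTau_mem_range_map_singularModuliField`, koly p417167, conductor 1;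
`phi_heegnerPointOfConductor_mem_range_map_ringClassField` + `exists_generator_ringClassGalOver`, koly p421526,
square-free conductor), consumed by koly's `Theorems/KolyvaginRoadThreeLevelData.lean` (p423680:
`Nonempty (KolyvaginHeegnerData Dt β ι n)` at every square-free level with inert prime factors). Hence ANY tree
proof of the item as filed (or of its X11b ∕ HL restates) is CONDITIONAL on those facts and cannot close the item
`proved` (D-0014: the item closes only if its own signature is proved). Moving the seam INTO the statement as a
PREMISE of the conclusion repairs this at no mathematical cost: the crux then asks for the non-vanishing class
GIVEN the data at every square-free inert level on the frame — exactly the tower point form of zhang3-p1 g0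
(`KolyCert.towerCertificates_of_zhangSharpFrameAtThree`, p420076, whose hypothesis `hKD` IS this premise
quantified over frames). This file supplies the matching kernel:

* `Koly.bsdp_three_onA1_of_kolyvaginFramesHLSeam` — the A1 kernel with `hZ` in the HL-sharp shape of
  `KolyvaginRoadThreeKernelHL.lean` PLUS the premise
  `(∀ m, Squarefree m → (∀ q ∈ m.primeFactors, (Ideal.span {(q : 𝓞 K)}).IsPrime) → Nonempty (KolyvaginHeegnerData Dt β ι m))`
  before the conclusion, and with the conductor-1 seam `hKD` REPLACED by the tower seam `hKDn` (zhang3-p1 g0's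
  `hKD`-at-level-`m` shape verbatim = the conclusion of koly's `kolyvaginRoadThree_towerData_of_grossCM`); a
  COROLLARY of `bsdp_three_onA1_of_kolyvaginFramesHL` (level `1` is the square-free level with no prime
  factors; the premise of `hZ` is `hKDn` at the frame) — no proof text is duplicated;
* `Koly.kolyvaginFramesHLSeam_of_kolyvaginFramesHL` — the HL shape implies the HL+seam shape (WEAKER again:
  filed ⇒ X11b ⇒ HL ⇒ HL+seam);
* `Theorems.bsdp_three_onA1_of_kolyvaginFramesHLSeam_of_grossCM` — the tower seam DISCHARGED BY NAME from the two
  CM facts (koly p421526 via p423680), so that on A1 `BSD(E,3)` follows from published named facts and the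
  HL+seam crux ALONE.
GLUE NOTE for the planner: with this statement the re-certified `closes` needs the tower seam from the SUPPORT item —
restate `PublishedInputsKolyThree`'s last conjunct from the conductor-1 seam to the ∀-level seam (the `hKDn` shape
below; provable now by `kolyvaginRoadThree_towerData_of_grossCM` from the two facts, or cite the two fact names as
conjuncts) — then the A1 case of `closes` is `Koly.bsdp_three_onA1_of_kolyvaginFramesHLSeam … hKDn g₁ W hX hram htam`.

References (locators only): [cite: GrossLMS1991, §3 (x_n rational over K_n), §4 (4.1)]
[cite: WZhang2014, Thm. 1.1, Remark 5 and Thm. 10.2 (analytic rank one)] [cite: McCallumLMS1991, §5 Cor. 5.6 (p. 310)]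
[cite: Darmon2004, Thm. 3.6 (PDF pp. 43–44)].
-/

noncomputable section

open scoped Classical

namespace Summit.BirchSwinnertonDyer.Rank1Residual.X11b.Three.Koly

open WeierstrassCurve NumberField Literature.NumberTheory.EllipticCurves
  Literature.NumberTheory.EllipticCurves.ModularForms
  Literature.NumberTheory.EllipticCurves.Rank1Residual
  Summit.BirchSwinnertonDyer.Rank1Residual Summit.BirchSwinnertonDyer.Rank1Residual.X11b

/-- **The A1 kernel of route `KolyvaginRoadThree` with the crux in the CLOSABLE-IN-PRINCIPLE shape**: `hZ` is
Kolyvagin's conjecture mod 3 at every Manin-good conductor-1 frame of every Hoffstein–Luo pair on A1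
(`ClassX11b W 3`, `d_K` odd, `L(E^{d_K},1) ≠ 0`), GIVEN Kolyvagin–Heegner data at every square-free level with
inert prime factors on that frame (the premise before `∃ n d`); the kernel's seam is the TOWER seam `hKDn` (data
at all such levels on all admissible frames — CM theory, Gross 1991 §3; dischargeable by name from koly's p421526
via p423680). Proof: the HL kernel `bsdp_three_onA1_of_kolyvaginFramesHL` (p424749) with its conductor-1 seam
read off `hKDn` at `m = 1` and its `hZ` obtained from this `hZ` by feeding `hKDn` at the frame. CONDITIONAL on
every binder; nothing booked. [cite: GrossLMS1991, §3 and §4 (4.1)] [cite: WZhang2014, Thm. 1.1 and Remark 5]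
[cite: McCallumLMS1991, §5 Cor. 5.6 (p. 310)] -/
theorem bsdp_three_onA1_of_kolyvaginFramesHLSeam
    -- published named facts
    (hGZ : ∀ (N : ℕ) [NeZero N] (W : WeierstrassCurve ℚ) (K : Type) [Field K] [NumberField K],
      gross_zagier N W K)
    (hKo : ∀ (N : ℕ) [NeZero N] (W : WeierstrassCurve ℚ) (K : Type) [Field K] [NumberField K],
      kolyvagin N W K)
    (hB : ∀ (N : ℕ) [NeZero N] (W : WeierstrassCurve ℚ) (K : Type) [Field K] [NumberField K],
      Kolyvagin1990_padicValNat_card_sha_le N W K)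
    (hSk : Skinner2016.thmC_padicValRat_bsd_rank_zero)
    (hGZK : rank_eq_analyticRank_of_analyticRank_le_one) (hmod : hasEntireLFunction_rat)
    (hnf : exists_isNewformOf) (hHL : HoffsteinLuo1997_exists_twist_L_one_ne_zero)
    (hMaz : mazur_not_dvd_maninConstant_of_odd)
    (hrec : ∀ (N : ℕ) [NeZero N] (W : WeierstrassCurve ℚ) (K : Type) [Field K] [NumberField K],
      heegnerPointOfConductor_one_galoisConj N W K)
    (hMc : McCallum1991_pow_dvd_card_sha_primary_of_certificate)
    -- TOWER SEAM: Kolyvagin–Heegner data exist at every square-free inert level on every admissible frame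
    (hKDn : ∀ (W : WeierstrassCurve ℚ) [W.IsElliptic] [W.IsGloballyMinimal] [NeZero (W.conductorNorm ℤ)]
      (K : Type) [Field K] [NumberField K]
      (Dt : ModularParametrizationData W (W.conductorNorm ℤ)) (β : ℤ) (ι : K →+* ℂ) (m : ℕ),
      IsImaginaryQuadratic K → SatisfiesHeegnerHypothesis (W.conductorNorm ℤ) K →
      (4 * (W.conductorNorm ℤ : ℤ)) ∣ β ^ 2 - NumberField.discr K → Squarefree m →
      (∀ q ∈ m.primeFactors, (Ideal.span {(q : 𝓞 K)}).IsPrime) →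
      Nonempty (KolyvaginHeegnerData Dt β ι m))
    -- SEAM G-b, HL-SHARP, GIVEN THE DATA: Kolyvagin's conjecture mod 3 at every Manin-good frame of an HL pair
    (hZ : ∀ (W : WeierstrassCurve ℚ) [W.IsElliptic] [W.IsGloballyMinimal] [NeZero (W.conductorNorm ℤ)]
      (K : Type) [Field K] [NumberField K]
      (Dt : ModularParametrizationData W (W.conductorNorm ℤ)) (β : ℤ) (ι : K →+* ℂ),
      ClassX11b W 3 → W.HasMultiplicativeReductionAtPrime 3 → Rank1Residual.Surj W 3 →
      Rank1Residual.Ram W 3 → ¬ 3 ∣ W.tamagawaProduct →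
      IsImaginaryQuadratic K → Odd (NumberField.discr K) →
      SatisfiesHeegnerHypothesis (W.conductorNorm ℤ) K →
      (W.quadraticTwist (NumberField.discr K : ℚ)).entireLFunction 1 ≠ 0 →
      NumberField.discr K ≠ -3 →
      (4 * (W.conductorNorm ℤ : ℤ)) ∣ β ^ 2 - NumberField.discr K → ¬ (3 : ℤ) ∣ Dt.c →
      (∀ m : ℕ, Squarefree m → (∀ q ∈ m.primeFactors, (Ideal.span {(q : 𝓞 K)}).IsPrime) →
        Nonempty (KolyvaginHeegnerData Dt β ι m)) →
      ∃ (n : ℕ) (d : KolyvaginHeegnerData Dt β ι n),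
        KolyvaginDescent.KolSupp (Zhang2014.IsKolyvaginPrime (W.conductorNorm ℤ) W K 3) n ∧
          d.kolyvaginClass Nat.prime_three 1 ≠ 0)
    -- the pair
    (W : WeierstrassCurve ℚ) [W.IsElliptic] [W.IsGloballyMinimal]
    (hX : ClassX11b W 3) (hram : Ram W 3) (htam : ¬ 3 ∣ W.tamagawaProduct) : BSDp W 3 :=
  bsdp_three_onA1_of_kolyvaginFramesHL hGZ hKo hB hSk hGZK hmod hnf hHL hMaz hrec hMc
    (fun W' _ _ _ K' _ _ Dt' β' ι' hK hH hβ ↦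
      hKDn W' K' Dt' β' ι' 1 hK hH hβ squarefree_one (by simp [Nat.primeFactors_one]))
    (fun W' _ _ _ K' _ _ Dt' β' ι' hX' hmult hsurj hram' htam' hK hodd hH hLt h3 hβ hc ↦
      hZ W' K' Dt' β' ι' hX' hmult hsurj hram' htam' hK hodd hH hLt h3 hβ hc
        (fun m hm hinert ↦ hKDn W' K' Dt' β' ι' m hK hH hβ hm hinert))
    W hX hram htam

/-- **The HL shape implies the HL+seam shape** (WEAKER again: filed ⇒ X11b ⇒ HL ⇒ HL+seam; pure logic — ignore
the data premise). [folklore] -/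
theorem kolyvaginFramesHLSeam_of_kolyvaginFramesHL
    (hZ : ∀ (W : WeierstrassCurve ℚ) [W.IsElliptic] [W.IsGloballyMinimal] [NeZero (W.conductorNorm ℤ)]
      (K : Type) [Field K] [NumberField K]
      (Dt : ModularParametrizationData W (W.conductorNorm ℤ)) (β : ℤ) (ι : K →+* ℂ),
      ClassX11b W 3 → W.HasMultiplicativeReductionAtPrime 3 → Rank1Residual.Surj W 3 →
      Rank1Residual.Ram W 3 → ¬ 3 ∣ W.tamagawaProduct →
      IsImaginaryQuadratic K → Odd (NumberField.discr K) →
      SatisfiesHeegnerHypothesis (W.conductorNorm ℤ) K →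
      (W.quadraticTwist (NumberField.discr K : ℚ)).entireLFunction 1 ≠ 0 →
      NumberField.discr K ≠ -3 →
      (4 * (W.conductorNorm ℤ : ℤ)) ∣ β ^ 2 - NumberField.discr K → ¬ (3 : ℤ) ∣ Dt.c →
      ∃ (n : ℕ) (d : KolyvaginHeegnerData Dt β ι n),
        KolyvaginDescent.KolSupp (Zhang2014.IsKolyvaginPrime (W.conductorNorm ℤ) W K 3) n ∧
          d.kolyvaginClass Nat.prime_three 1 ≠ 0) :
    ∀ (W : WeierstrassCurve ℚ) [W.IsElliptic] [W.IsGloballyMinimal] [NeZero (W.conductorNorm ℤ)]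
      (K : Type) [Field K] [NumberField K]
      (Dt : ModularParametrizationData W (W.conductorNorm ℤ)) (β : ℤ) (ι : K →+* ℂ),
      ClassX11b W 3 → W.HasMultiplicativeReductionAtPrime 3 → Rank1Residual.Surj W 3 →
      Rank1Residual.Ram W 3 → ¬ 3 ∣ W.tamagawaProduct →
      IsImaginaryQuadratic K → Odd (NumberField.discr K) →
      SatisfiesHeegnerHypothesis (W.conductorNorm ℤ) K →
      (W.quadraticTwist (NumberField.discr K : ℚ)).entireLFunction 1 ≠ 0 →
      NumberField.discr K ≠ -3 →
      (4 * (W.conductorNorm ℤ : ℤ)) ∣ β ^ 2 - NumberField.discr K → ¬ (3 : ℤ) ∣ Dt.c →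
      (∀ m : ℕ, Squarefree m → (∀ q ∈ m.primeFactors, (Ideal.span {(q : 𝓞 K)}).IsPrime) →
        Nonempty (KolyvaginHeegnerData Dt β ι m)) →
      ∃ (n : ℕ) (d : KolyvaginHeegnerData Dt β ι n),
        KolyvaginDescent.KolSupp (Zhang2014.IsKolyvaginPrime (W.conductorNorm ℤ) W K 3) n ∧
          d.kolyvaginClass Nat.prime_three 1 ≠ 0 :=
  fun W _ _ _ K _ _ Dt β ι hX hmult hsurj hram htam hK hodd hH hLt h3 hβ hc _ ↦
    hZ W K Dt β ι hX hmult hsurj hram htam hK hodd hH hLt h3 hβ hc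

end Summit.BirchSwinnertonDyer.Rank1Residual.X11b.Three.Koly

namespace Summit.BirchSwinnertonDyer.BirchSwinnertonDyer.Theorems

open WeierstrassCurve NumberField Literature.NumberTheory.EllipticCurves
  Literature.NumberTheory.EllipticCurves.ModularForms
  Literature.NumberTheory.EllipticCurves.Rank1Residual
  Summit.BirchSwinnertonDyer.Rank1Residual Summit.BirchSwinnertonDyer.Rank1Residual.X11b

/-- **The closable-in-principle A1 kernel with the tower seam DISCHARGED BY NAME**:
`Koly.bsdp_three_onA1_of_kolyvaginFramesHLSeam` with `hKDn` supplied from Gross 1991 §3's two CM facts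
(`phi_heegnerPointOfConductor_mem_range_map_ringClassField`, `exists_generator_ringClassGalOver`, koly p421526) by
koly's `kolyvaginRoadThree_towerData_of_grossCM` (p423680). Under the published named facts and the HL+seam crux
in hypothesis shape `hZ`: `BSD(E,3)` for every `E` on atom A1. CONDITIONAL on every binder; nothing booked.
[cite: GrossLMS1991, §3 (x_n rational over K_n; G_ℓ cyclic)] [cite: Darmon2004, Thm. 3.6 (PDF pp. 43–44)]
[cite: McCallumLMS1991, §5 Cor. 5.6 (p. 310)] -/
theorem bsdp_three_onA1_of_kolyvaginFramesHLSeam_of_grossCM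
    (hGZ : ∀ (N : ℕ) [NeZero N] (W : WeierstrassCurve ℚ) (K : Type) [Field K] [NumberField K],
      gross_zagier N W K)
    (hKo : ∀ (N : ℕ) [NeZero N] (W : WeierstrassCurve ℚ) (K : Type) [Field K] [NumberField K],
      kolyvagin N W K)
    (hB : ∀ (N : ℕ) [NeZero N] (W : WeierstrassCurve ℚ) (K : Type) [Field K] [NumberField K],
      Kolyvagin1990_padicValNat_card_sha_le N W K)
    (hSk : Skinner2016.thmC_padicValRat_bsd_rank_zero)
    (hGZK : rank_eq_analyticRank_of_analyticRank_le_one) (hmod : hasEntireLFunction_rat)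
    (hnf : exists_isNewformOf) (hHL : HoffsteinLuo1997_exists_twist_L_one_ne_zero)
    (hMaz : mazur_not_dvd_maninConstant_of_odd)
    (hrec : ∀ (N : ℕ) [NeZero N] (W : WeierstrassCurve ℚ) (K : Type) [Field K] [NumberField K],
      heegnerPointOfConductor_one_galoisConj N W K)
    (hMc : McCallum1991_pow_dvd_card_sha_primary_of_certificate)
    (hx : ∀ (N : ℕ) [NeZero N] (W : WeierstrassCurve ℚ) (K : Type) [Field K] [NumberField K],
      phi_heegnerPointOfConductor_mem_range_map_ringClassField N W K)
    (hσ : ∀ (K : Type) [Field K] [NumberField K], exists_generator_ringClassGalOver K)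
    (hZ : ∀ (W : WeierstrassCurve ℚ) [W.IsElliptic] [W.IsGloballyMinimal] [NeZero (W.conductorNorm ℤ)]
      (K : Type) [Field K] [NumberField K]
      (Dt : ModularParametrizationData W (W.conductorNorm ℤ)) (β : ℤ) (ι : K →+* ℂ),
      ClassX11b W 3 → W.HasMultiplicativeReductionAtPrime 3 → Rank1Residual.Surj W 3 →
      Rank1Residual.Ram W 3 → ¬ 3 ∣ W.tamagawaProduct →
      IsImaginaryQuadratic K → Odd (NumberField.discr K) →
      SatisfiesHeegnerHypothesis (W.conductorNorm ℤ) K →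
      (W.quadraticTwist (NumberField.discr K : ℚ)).entireLFunction 1 ≠ 0 →
      NumberField.discr K ≠ -3 →
      (4 * (W.conductorNorm ℤ : ℤ)) ∣ β ^ 2 - NumberField.discr K → ¬ (3 : ℤ) ∣ Dt.c →
      (∀ m : ℕ, Squarefree m → (∀ q ∈ m.primeFactors, (Ideal.span {(q : 𝓞 K)}).IsPrime) →
        Nonempty (KolyvaginHeegnerData Dt β ι m)) →
      ∃ (n : ℕ) (d : KolyvaginHeegnerData Dt β ι n),
        KolyvaginDescent.KolSupp (Zhang2014.IsKolyvaginPrime (W.conductorNorm ℤ) W K 3) n ∧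
          d.kolyvaginClass Nat.prime_three 1 ≠ 0)
    (W : WeierstrassCurve ℚ) [W.IsElliptic] [W.IsGloballyMinimal]
    (hX : ClassX11b W 3) (hram : Ram W 3) (htam : ¬ 3 ∣ W.tamagawaProduct) : BSDp W 3 :=
  Summit.BirchSwinnertonDyer.Rank1Residual.X11b.Three.Koly.bsdp_three_onA1_of_kolyvaginFramesHLSeam hGZ hKo hB
    hSk hGZK hmod hnf hHL hMaz hrec hMc (kolyvaginRoadThree_towerData_of_grossCM hx hσ) hZ W hX hram htam

end Summit.BirchSwinnertonDyer.BirchSwinnertonDyer.Theorems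

end
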